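import Summits.CriticalPhenomena.PercolationContinuityZ3.Theorems.PercNearOneGluingNoHeavyLowerTailSahiTwoLevelVariationalMoves
import Mathlib.Tactic.Linarith
import HarnessLib

/-!
# SHELL MOVES of the two-level TOP law: a cost-free shell may be filled (slot becomes idle at its top), a shell inside the meet of the
# partner tops may be deleted (slot becomes idle at its bottom) — two reductions of `T⁺ ≥ 0` to the idle configuration

Support file of the one-cut programme (crux `NoHeavyLowerTail`, stmt-CriticalPhenomena-4575; master-family line P2, seat `prim-masterthm-p2`
gen 21; memo `run/shared/lean/prim/prim-masterthm/FROM-prim-masterthm-p2-g21-TOP-ABSORBING.md` §2, §4).  No definition, no sorry; axioms standard.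

SETTING (`…SahiTwoLevelVariational{,Moves}`): `T⁺(G,H) = topForm q G H` for a nested pair `H_i ⊆ G_i` of triples of increasing events,
shell `D_i = G_i ∖ H_i`.  Two of the four monotone moves of gen 20, pushed to their natural end points:
* `topForm_idleTop₀_le` — **COST-FREE SHELL**: if `D₀ ∩ H₁ ∩ H₂ = ∅` then move (B+) may add the whole shell to the bottom:
  `T⁺(G, (G₀, H₁, H₂)) ≤ T⁺(G, H)` — slot `0` becomes IDLE at `F = G₀`.
* `topForm_idleBottom₀_le` — **SHELL INSIDE THE MEET**: if `D₀ ⊆ G₁ ∩ G₂` then move (T−) may delete the whole shell from the top: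
  `T⁺((H₀, G₁, G₂), H) ≤ T⁺(G, H)` — slot `0` becomes IDLE at `F = H₀`.
* `mixedE3Nonneg_idleTop₀`, `mixedE3Nonneg_idleBottom₀` — the hypothesis "`E_3 ≥ 0` for triples drawn from the six events" passes to the
  idle-ised pairs (their events are among the original six);
* **`topForm_nonneg_of_costfreeShell₀`**, **`topForm_nonneg_of_shellInside₀`** — hence `T⁺(G,H) ≥ 0` whenever the idle-ised pair lies in a
  solved face (`SahiTwoLevelVariational.InSolvedFace`: W-face, costless-inside, independent tops, `κ₃ ≥ 0`, idle + bracket), given `E_3 ≥ 0`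
  for the mixed triples (the induction hypothesis of `kahnConjecture_of_solvedFaceDescent`).
These are the two non-fill steps of the "canonical saturation" of the memo's census (code/gen21/saturate.py); on `{0,1}^3` they send 2 958 of
the 3 558 configurations left open by the older faces and the top-absorbing face into the idle+bracket / costless-inside faces.
HONEST LABEL: one-sided inequalities (Harris) and their packaging; nothing here asserts `SahiTwoLevelPlus` or Kahn's Conjecture 5 (OPEN). [this work]
-/

noncomputable section

open scoped Classical

namespace Summit.CriticalPhenomena.PercolationContinuityZ3.Theorems

namespace SahiTwoLevelVariational

open Finset Function MeasureTheory
open Literature.Combinatorics.Sahi2008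
open Literature.Probability.LatticeModels (prodBernoulli prodBernoulli_harris sahiE3)

variable {κ : Type} [Fintype κ]

/-! ### 1. The two shell moves -/

/-- **COST-FREE SHELL ⟹ fill it (slot `0` idle at its top).**  If the shell `G₀ ∖ H₀` avoids `H₁ ∩ H₂` then
`T⁺(G,(G₀,H₁,H₂)) ≤ T⁺(G,H)` (move (B+); tops `G₁, G₂` increasing). [this work] -/
theorem topForm_idleTop₀_le (q : κ → unitInterval) (G H : Fin 3 → Set (Set κ))
    (hG1 : IsUpperSet (G 1)) (hG2 : IsUpperSet (G 2)) (hHG0 : H 0 ⊆ G 0)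
    (hcf : (G 0 \ H 0) ∩ H 1 ∩ H 2 = ∅) :
    topForm q G ![G 0, H 1, H 2] ≤ topForm q G H := by
  have h := topForm_bottom_union_le q G (H 0) (G 0 \ H 0) (H 1) (H 2) hG1 hG2 Set.disjoint_sdiff_right hcf
  have hH : (![H 0, H 1, H 2] : Fin 3 → Set (Set κ)) = H := by funext i; fin_cases i <;> rfl
  rwa [Set.union_sdiff_cancel hHG0, hH] at h

/-- **SHELL INSIDE THE MEET ⟹ delete it (slot `0` idle at its bottom).**  If `G₀ ∖ H₀ ⊆ G₁ ∩ G₂` then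
`T⁺((H₀,G₁,G₂),H) ≤ T⁺(G,H)` (move (T−); `H₁ ⊆ G₁`, `H₂ ⊆ G₂`). [this work] -/
theorem topForm_idleBottom₀_le (q : κ → unitInterval) (G H : Fin 3 → Set (Set κ))
    (hHG : ∀ i, H i ⊆ G i) (hin : G 0 \ H 0 ⊆ G 1 ∩ G 2) :
    topForm q ![H 0, G 1, G 2] H ≤ topForm q G H := by
  have hK : G 0 \ H 0 ⊆ G 0 ∩ G 1 ∩ G 2 := fun ω hω => ⟨⟨hω.1, (hin hω).1⟩, (hin hω).2⟩
  have h := topForm_top_sdiff_le q H (G 0) (G 0 \ H 0) (G 1) (G 2) (hHG 1) (hHG 2) hK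
  have hG : (![G 0, G 1, G 2] : Fin 3 → Set (Set κ)) = G := by funext i; fin_cases i <;> rfl
  rwa [Set.sdiff_sdiff_cancel_left (hHG 0), hG] at h

/-! ### 2. The mixed-`E_3` hypothesis passes to the idle-ised pairs -/

omit [Fintype κ] in
/-- `MixedE3Nonneg` for `(G, (G₀,H₁,H₂))` from `MixedE3Nonneg` for `(G,H)`. [this work] -/
theorem mixedE3Nonneg_idleTop₀ (q : κ → unitInterval) {G H : Fin 3 → Set (Set κ)} (hE : MixedE3Nonneg q G H) :
    MixedE3Nonneg q G ![G 0, H 1, H 2] := by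
  intro X hX
  refine hE X fun i => ?_
  obtain ⟨j, hj | hj⟩ := hX i
  · exact ⟨j, Or.inl hj⟩
  · fin_cases j
    · exact ⟨0, Or.inl (by simpa using hj)⟩
    · exact ⟨1, Or.inr (by simpa using hj)⟩
    · exact ⟨2, Or.inr (by simpa using hj)⟩

omit [Fintype κ] in
/-- `MixedE3Nonneg` for `((H₀,G₁,G₂), H)` from `MixedE3Nonneg` for `(G,H)`. [this work] -/
theorem mixedE3Nonneg_idleBottom₀ (q : κ → unitInterval) {G H : Fin 3 → Set (Set κ)} (hE : MixedE3Nonneg q G H) :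
    MixedE3Nonneg q ![H 0, G 1, G 2] H := by
  intro X hX
  refine hE X fun i => ?_
  obtain ⟨j, hj | hj⟩ := hX i
  · fin_cases j
    · exact ⟨0, Or.inr (by simpa using hj)⟩
    · exact ⟨1, Or.inl (by simpa using hj)⟩
    · exact ⟨2, Or.inl (by simpa using hj)⟩
  · exact ⟨j, Or.inr hj⟩

/-! ### 3. Reductions of the top law to the idle configuration -/

/-- **COST-FREE SHELL + a solved face at the filled configuration ⟹ `T⁺ ≥ 0`.** [this work] -/
theorem topForm_nonneg_of_costfreeShell₀ (q : κ → unitInterval) (G H : Fin 3 → Set (Set κ))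
    (hG : ∀ i, IsUpperSet (G i)) (hH : ∀ i, IsUpperSet (H i)) (hHG : ∀ i, H i ⊆ G i)
    (hE : MixedE3Nonneg q G H) (hcf : (G 0 \ H 0) ∩ H 1 ∩ H 2 = ∅)
    (hface : InSolvedFace q G ![G 0, H 1, H 2]) : 0 ≤ topForm q G H := by
  refine le_trans ?_ (topForm_idleTop₀_le q G H (hG 1) (hG 2) (hHG 0) hcf)
  refine topForm_nonneg_of_inSolvedFace q G _ hG ?_ ?_ (mixedE3Nonneg_idleTop₀ q hE) hface
  · intro i; fin_cases i
    · exact hG 0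
    · exact hH 1
    · exact hH 2
  · intro i; fin_cases i
    · exact le_rfl
    · exact hHG 1
    · exact hHG 2

/-- **SHELL INSIDE THE MEET + a solved face at the deleted configuration ⟹ `T⁺ ≥ 0`.** [this work] -/
theorem topForm_nonneg_of_shellInside₀ (q : κ → unitInterval) (G H : Fin 3 → Set (Set κ))
    (hG : ∀ i, IsUpperSet (G i)) (hH : ∀ i, IsUpperSet (H i)) (hHG : ∀ i, H i ⊆ G i)
    (hE : MixedE3Nonneg q G H) (hin : G 0 \ H 0 ⊆ G 1 ∩ G 2)
    (hface : InSolvedFace q ![H 0, G 1, G 2] H) : 0 ≤ topForm q G H := by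
  refine le_trans ?_ (topForm_idleBottom₀_le q G H hHG hin)
  refine topForm_nonneg_of_inSolvedFace q _ H ?_ hH ?_ (mixedE3Nonneg_idleBottom₀ q hE) hface
  · intro i; fin_cases i
    · exact hH 0
    · exact hG 1
    · exact hG 2
  · intro i; fin_cases i
    · exact le_rfl
    · exact hHG 1
    · exact hHG 2

/-- **SHELL INSIDE THE MEET, then TOP-ABSORBING at the deleted configuration** (no `E_3` hypothesis): if `G₀ ∖ H₀ ⊆ G₁ ∩ G₂` and
`H₀ ∩ G₂ ⊆ G₁` (slot `1` of `(H₀,G₁,G₂)` absorbing), then `T⁺(G,H) ≥ 0`: move (T−) on slot `0`, move (T+) on slot `1` to the sure event,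
independent tops. [this work] -/
theorem topForm_nonneg_of_shellInside₀_absorbing₁ (q : κ → unitInterval) (G H : Fin 3 → Set (Set κ))
    (hG : ∀ i, IsUpperSet (G i)) (hH : ∀ i, IsUpperSet (H i)) (hHG : ∀ i, H i ⊆ G i)
    (hin : G 0 \ H 0 ⊆ G 1 ∩ G 2) (habs : G 2 ∩ H 0 ⊆ G 1) : 0 ≤ topForm q G H := by
  refine le_trans ?_ (topForm_idleBottom₀_le q G H hHG hin)
  -- at `((H₀,G₁,G₂),H)` slot 1 is top-absorbing: rotate it to slot 0 and fill
  have hG' : ∀ i, IsUpperSet ((![H 0, G 1, G 2] : Fin 3 → Set (Set κ)) i) := by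
    intro i; fin_cases i
    · exact hH 0
    · exact hG 1
    · exact hG 2
  have hHG' : ∀ i, H i ⊆ (![H 0, G 1, G 2] : Fin 3 → Set (Set κ)) i := by
    intro i; fin_cases i
    · exact le_rfl
    · exact hHG 1
    · exact hHG 2
  rw [← topForm_rot]
  have hA : ((rot ![H 0, G 1, G 2]) 0)ᶜ ∩ (rot ![H 0, G 1, G 2]) 1 ∩ (rot ![H 0, G 1, G 2]) 2 = ∅ := by
    refine Set.subset_empty_iff.1 fun ω hω => (hω.1.1 ?_).elim
    have h2 : ω ∈ G 2 := by simpa [rot] using hω.1.2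
    have h0 : ω ∈ H 0 := by simpa [rot] using hω.2
    simpa [rot] using habs ⟨h2, h0⟩
  have hfill := topForm_top_union_le q (rot H) ((rot ![H 0, G 1, G 2]) 0) ((rot ![H 0, G 1, G 2]) 0)ᶜ
    ((rot ![H 0, G 1, G 2]) 1) ((rot ![H 0, G 1, G 2]) 2)
    (by simpa [rot] using hH 2) (by simpa [rot] using hH 0) (by simpa [rot] using hHG 2) (by simp [rot])
    disjoint_compl_right hA
  have hvec : (![(rot ![H 0, G 1, G 2]) 0, (rot ![H 0, G 1, G 2]) 1, (rot ![H 0, G 1, G 2]) 2] : Fin 3 → Set (Set κ))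
      = rot ![H 0, G 1, G 2] := by funext i; fin_cases i <;> rfl
  rw [Set.union_compl_self, hvec] at hfill
  refine le_trans ?_ hfill
  rw [topForm_def]
  refine SahiTwoLevelIndep.twoLevelPlus_nonneg_of_determinedBy q Finset.univ _ (rot H) ?_ ?_ ?_ ?_ ?_
  · intro i; fin_cases i
    · exact isUpperSet_univ
    · simpa [rot] using hG 2
    · simpa [rot] using hH 0
  · intro i; fin_cases i
    · simpa [rot] using hH 1
    · simpa [rot] using hH 2
    · simpa [rot] using hH 0
  · intro i; fin_cases i
    · exact Set.subset_univ _
    · simpa [rot] using hHG 2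
    · simp [rot]
  · exact Literature.Probability.Percolation.determinedBy_univ _
  · exact (Literature.Probability.Percolation.determinedBy_iff _ _).2 fun ω ω' hω => by
      rw [Finset.coe_univ, Set.inter_univ, Set.inter_univ] at hω; rw [hω]

end SahiTwoLevelVariational

end Summit.CriticalPhenomena.PercolationContinuityZ3.Theorems
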